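import Literature.Probability.RandomPlanarGeometry.LoewnerArcDomain
import Literature.Probability.RandomPlanarGeometry.LoewnerRealPointProofs
import HarnessLib

/-!
# After a simple excursion of the trace, no boundary point is swallowed quickly

Topic `Probability/RandomPlanarGeometry`; deterministic (any continuous driving function `W`).
Let the chain of `W` be generated by `γ`, and suppose that on `[0, s + ε]` the curve is
injective and that `γ[s, s + ε]` lies in the open upper half-plane (a simple excursion of the
tip `γ s ∈ ℍ` into the Loewner domain `Hₛ`, cf. `LoewnerArcDomain.lean`). Consider the
**shifted chain** driven by `W(s + ·)` (the conformal Markov picture: its hulls are the images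
`gₛ(K_{s+t} ∖ Kₛ)`, `Loewner.mem_hull_iff_map_mem_hull`). We prove:

* `Literature.Probability.RandomPlanarGeometry.Loewner.IsGeneratedByCurve.hull_shift_subset_image`
  — for `t ≤ ε`, the shifted hull at time `t` is contained in `gₛ(γ(s, s+t])`
  (`LoewnerArcDomain`: `K_{s+t} = Kₛ ∪ γ(s, s+t]`);
* `Literature.Probability.RandomPlanarGeometry.Loewner.IsGeneratedByCurve.eq_driving_of_mem_closure_hull_shift`
  — the only real point in the closure of the shifted hull at time `ε` is the driving point
  `W s` (points `gₛ(γ r)` tend to `W s` as `r ↓ s`, the shifted hull at time `r - s` being small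
  about `W s`, `Loewner.hull_subset_closedBall_driving`; and `gₛ ∘ γ` is continuous with values in
  `ℍ` on `(s, s + ε]`);
* `Literature.Probability.RandomPlanarGeometry.Loewner.IsGeneratedByCurve.lt_swallowingTime_shift`
  — consequently **every real point `x ≠ W s` has swallowing time `> ε` in the shifted chain**
  ("real points outside the closed hull are still flowing",
  `Loewner.lt_swallowingTime_of_notMem_closure_hull_holds`, Lawler (2005) §4.1).

For SLE_κ with `κ > 4` real points near the driving point ARE swallowed quickly (a.s.), so an
injective trace is impossible: this is the deterministic half of the a.s. non-simplicity of the
trace for `κ > 4` (Rohde–Schramm (2005), §1; Schramm (2000)).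

## References

* G. F. Lawler, *Conformally Invariant Processes in the Plane* (2005), §4.1 (real points and the
  closed hull), Lemma 4.13 (size of the hull), Rem. 4.9 (the shifted chain), §4.4.
* S. Rohde, O. Schramm, *Basic properties of SLE*, Ann. of Math. 161 (2005), §1, §6.
-/

noncomputable section

open Set Filter Metric Bornology Complex
open _root_.Topology
open UpperHalfPlane (upperHalfPlaneSet isOpen_upperHalfPlaneSet)
open scoped NNReal

namespace Literature.Probability.RandomPlanarGeometry

namespace Loewner

variable {W : ℝ≥0 → ℝ} {γ : ℝ≥0 → ℂ}

/-- Under injectivity on `[0, s + ε]`, the curve does not return to its past `γ[0, s]` during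
`(s, s + ε]`. [folklore] -/
theorem notMem_image_Icc_of_injOn {s ε : ℝ≥0} (hinj : InjOn γ (Icc 0 (s + ε))) {r : ℝ≥0}
    (hsr : s < r) (hr : r ≤ s + ε) : γ r ∉ γ '' Icc 0 s := by
  rintro ⟨u, hu, hur⟩
  have h := hinj ⟨bot_le, hu.2.trans le_self_add⟩ ⟨bot_le, hr⟩ hur
  rw [h] at hu
  exact absurd hu.2 (not_le.2 hsr)

section Shift

variable (hγ : IsGeneratedByCurve W γ) (hW : Continuous W) {s ε : ℝ≥0}
  (hinj : InjOn γ (Icc 0 (s + ε))) (him : ∀ r, s ≤ r → r ≤ s + ε → 0 < (γ r).im)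
include hγ hW hinj him

/-- Points of the excursion after time `s` lie in the Loewner domain `Hₛ`. [folklore] -/
theorem IsGeneratedByCurve.mem_domain_of_excursion {r : ℝ≥0} (hsr : s < r) (hr : r ≤ s + ε) :
    γ r ∈ domain W s :=
  hγ.mem_domain_of_notMem hW hsr.le (notMem_image_Icc_of_injOn hinj hsr hr) (him r hsr.le hr)

/-- **The shifted hull lies on the image of the excursion**: for `t ≤ ε`, every point of the hull
at time `t` of the shifted chain `W(s + ·)` is `gₛ(γ r)` for some `r ∈ (s, s + t]`.
[cite: Lawler2005, Rem. 4.9] -/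
theorem IsGeneratedByCurve.hull_shift_subset_image {t : ℝ≥0} (ht : t ≤ ε) :
    hull (fun u ↦ W (s + u)) t ⊆ map W s '' (γ '' Ioc s (s + t)) := by
  intro w hw
  have hwH : w ∈ upperHalfPlaneSet := hull_subset _ t hw
  obtain ⟨z, hz, rfl⟩ := surjOn_map hW s hwH
  -- `z ∈ K_{s+t}`
  have hzK : z ∈ hull W (s + t) := by
    rw [mem_hull_iff_map_mem_hull hW hz (le_self_add : s ≤ s + t), add_tsub_cancel_left]
    exact hw
  -- `K_{s+t} = Kₛ ∪ γ[s, s+t]`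
  have hinj' : InjOn γ (Icc s (s + t)) := hinj.mono (Icc_subset_Icc bot_le (add_le_add le_rfl ht : s + t ≤ s + ε))
  have him' : ∀ r, s ≤ r → r ≤ s + t → 0 < (γ r).im := fun r h1 h2 ↦ him r h1 (h2.trans (add_le_add le_rfl ht : s + t ≤ s + ε))
  have hpast : ∀ r, s < r → r ≤ s + t → γ r ∉ γ '' Icc 0 s := fun r h1 h2 ↦
    notMem_image_Icc_of_injOn hinj h1 (h2.trans (add_le_add le_rfl ht : s + t ≤ s + ε))
  rw [hγ.hull_add_eq_union_image hW hinj' him' hpast] at hzK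
  rcases hzK with hzs | ⟨⟨r, hr, hrz⟩, -⟩
  · exact absurd hzs hz.2
  · refine ⟨γ r, ⟨r, ⟨?_, hr.2⟩, rfl⟩, by rw [hrz]⟩
    rcases hr.1.eq_or_lt with h | h
    · exfalso
      rw [← h] at hrz
      rw [← hrz] at hz
      exact (hγ.domain_subset_diff s hz).2 ⟨s, ⟨bot_le, le_rfl⟩, rfl⟩
    · exact h

/-- Points `gₛ(γ r)` of the shifted hulls are close to the driving point when `r` is close to
`s`: `‖gₛ(γ r) - W s‖ ≤ S + 4√(r - s)` whenever `|W(s+u) - W s| ≤ S` for `u ≤ r - s`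
(`hull_subset_closedBall_driving` for the shifted chain, Lawler's Lemma 4.13). [cite: Lawler2005, Lemma 4.13] -/
theorem IsGeneratedByCurve.norm_map_sub_driving_le {r : ℝ≥0} (hsr : s < r) (hr : r ≤ s + ε) {S : ℝ}
    (hS : ∀ u : ℝ≥0, u ≤ r - s → |W (s + u) - W s| ≤ S) :
    ‖map W s (γ r) - W s‖ ≤ S + 4 * Real.sqrt (r - s : ℝ≥0) := by
  have hz : γ r ∈ domain W s := hγ.mem_domain_of_excursion hW hinj him hsr hr
  have hK : γ r ∈ hull W r := hγ.mem_hull_of_mem_domain hz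
  have hmem : map W s (γ r) ∈ hull (fun u ↦ W (s + u)) (r - s) := by
    rw [← mem_hull_iff_map_mem_hull hW hz hsr.le]
    exact hK
  have h := hull_subset_closedBall_driving (continuous_shift W hW s) (u := r - s) (S := S)
    (fun u hu ↦ by simpa using hS u hu) hmem
  simpa [mem_closedBall, dist_eq_norm] using h

/-- **The only real point in the closure of the shifted hull at time `ε` is `W s`.** A real point
`p` of the closure is a limit of points `gₛ(γ rⱼ)`, `rⱼ ∈ (s, s + ε]`; along a convergent
subsequence `rⱼ → r⋆`: if `r⋆ > s` the limit is `gₛ(γ r⋆) ∈ ℍ`, not real; if `r⋆ = s` the limit is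
`W s` (`norm_map_sub_driving_le` and continuity of `W` at `s`). [folklore] -/
theorem IsGeneratedByCurve.eq_driving_of_mem_closure_hull_shift {p : ℝ}
    (hp : (p : ℂ) ∈ closure (hull (fun u ↦ W (s + u)) ε)) : p = W s := by
  -- a sequence in `gₛ(γ(s, s+ε])` converging to `p`
  have hp' : (p : ℂ) ∈ closure (map W s '' (γ '' Ioc s (s + ε))) :=
    closure_mono (hγ.hull_shift_subset_image hW hinj him le_rfl) hp
  obtain ⟨w, hw, hwp⟩ := mem_closure_iff_seq_limit.1 hp'
  choose z hz hzw using hw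
  choose r hr hrz using hz
  -- a convergent subsequence of times
  have hrI : ∀ j, r j ∈ Icc s (s + ε) := fun j ↦ ⟨(hr j).1.le, (hr j).2⟩
  obtain ⟨rs, hrs, φ, hφ, hlim⟩ := isCompact_Icc.tendsto_subseq hrI
  have hwφ : Tendsto (fun j ↦ w (φ j)) atTop (𝓝 (p : ℂ)) := hwp.comp hφ.tendsto_atTop
  have hweq : ∀ j, w j = map W s (γ (r j)) := fun j ↦ by rw [← hzw j, ← hrz j]
  rcases hrs.1.eq_or_lt with h | hlt
  · -- `r⋆ = s`: the points tend to `W s`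
    have hWs : Tendsto (fun j ↦ w (φ j)) atTop (𝓝 ((W s : ℝ) : ℂ)) := by
      rw [Metric.tendsto_atTop]
      intro δ hδ
      -- continuity of `W` at `s` and smallness of `4√(r - s)`
      have hWc : ContinuousAt (fun u : ℝ≥0 ↦ W (s + u)) 0 :=
        ((continuous_shift W hW s).continuousAt)
      obtain ⟨η, hη, hηW⟩ := Metric.continuousAt_iff.1 hWc (δ / 4) (by positivity)
      have hlim' : Tendsto (fun j ↦ ((r (φ j) - s : ℝ≥0) : ℝ)) atTop (𝓝 0) := by
        have h1 : Tendsto (fun j ↦ r (φ j)) atTop (𝓝 s) := by rw [h]; exact hlim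
        have h2 : Tendsto (fun j ↦ r (φ j) - s) atTop (𝓝 (s - s)) :=
          (h1.sub tendsto_const_nhds)
        rw [tsub_self] at h2
        rw [← NNReal.coe_zero]
        exact NNReal.tendsto_coe.2 h2
      have hsqrt : Tendsto (fun j ↦ 4 * Real.sqrt ((r (φ j) - s : ℝ≥0) : ℝ)) atTop (𝓝 0) := by
        have := (Real.continuous_sqrt.tendsto 0).comp hlim'
        rw [Real.sqrt_zero] at this
        simpa using this.const_mul 4
      have hev1 : ∀ᶠ j in atTop, ((r (φ j) - s : ℝ≥0) : ℝ) < η :=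
        hlim' (Iio_mem_nhds hη)
      have hev2 : ∀ᶠ j in atTop, 4 * Real.sqrt ((r (φ j) - s : ℝ≥0) : ℝ) < δ / 4 :=
        hsqrt (Iio_mem_nhds (by positivity))
      obtain ⟨N, hN⟩ := eventually_atTop.1 (hev1.and hev2)
      refine ⟨N, fun j hj ↦ ?_⟩
      obtain ⟨hj1, hj2⟩ := hN j hj
      have hS : ∀ u : ℝ≥0, u ≤ r (φ j) - s → |W (s + u) - W s| ≤ δ / 4 := by
        intro u hu
        have hu' : dist u 0 < η := by
          rw [NNReal.dist_eq, NNReal.coe_zero, sub_zero, abs_of_nonneg u.coe_nonneg]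
          exact lt_of_le_of_lt (by exact_mod_cast hu) hj1
        have := hηW hu'
        rw [add_zero, Real.dist_eq] at this
        exact this.le
      have hb := hγ.norm_map_sub_driving_le hW hinj him (hr (φ j)).1 (hr (φ j)).2 hS
      rw [dist_eq_norm, hweq]
      linarith
    have := tendsto_nhds_unique hwφ hWs
    exact_mod_cast this
  · -- `r⋆ > s`: the limit is `gₛ(γ r⋆) ∈ ℍ`, not real
    exfalso
    have hzdom : γ rs ∈ domain W s := hγ.mem_domain_of_excursion hW hinj him hlt hrs.2
    have hcont : ContinuousAt (fun u : ℝ≥0 ↦ map W s (γ u)) rs :=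
      (continuousAt_map hW ((mem_domain_iff W s _).1 hzdom).2).comp hγ.continuous.continuousAt
    have hlim2 : Tendsto (fun j ↦ w (φ j)) atTop (𝓝 (map W s (γ rs))) := by
      have := hcont.tendsto.comp hlim
      refine this.congr fun j ↦ ?_
      simp only [Function.comp_apply, hweq]
    have heq := tendsto_nhds_unique hwφ hlim2
    have hpos : 0 < (map W s (γ rs)).im := mapsTo_map hW s hzdom
    rw [← heq, ofReal_im] at hpos
    exact lt_irrefl _ hpos

/-- **No real point other than the driving point is swallowed by time `ε` in the shifted chain**:
for real `x ≠ W s`, `ε < T^{W(s+·)}_x` ("real points outside the closed hull are still flowing",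
`lt_swallowingTime_of_notMem_closure_hull_holds`). [cite: Lawler2005, Ch. 4 §4.1 p. 96 (before Lemma 4.13); Rem. 6.6 p. 148] -/
theorem IsGeneratedByCurve.lt_swallowingTime_shift {x : ℝ} (hx : x ≠ W s) :
    (ε : WithTop ℝ≥0) < swallowingTime (fun u ↦ W (s + u)) x := by
  have hW' : Continuous fun u ↦ W (s + u) := continuous_shift W hW s
  have hx' : (x : ℂ) ≠ ((fun u : ℝ≥0 ↦ W (s + u)) 0 : ℝ) := by
    simp only [add_zero]
    exact_mod_cast hx
  refine lt_swallowingTime_of_notMem_closure_hull_holds hW' hx' fun hmem ↦ hx ?_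
  exact hγ.eq_driving_of_mem_closure_hull_shift hW hinj him hmem

end Shift

end Loewner

end Literature.Probability.RandomPlanarGeometry
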